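import Literature.Geometry.Riemannian.NormalExpGaussLemma
import Literature.Geometry.Lorentzian.TwoParameterMaps
import HarnessLib

/-!
# Transverse Jacobi fields of a variation through normal geodesics: the initial derivative

Topic `Geometry/Riemannian`. For a curve `c` in `M` and a field `V` along `c` — in the
applications a curve in a hypersurface `P` and the unit normal field of `P` along it — the
variation through the geodesics `x(t, s) = exp_{c s}(t V s)` (`NormalExpGaussLemma.lean`) has the
variation field `J(t) = ∂_s x(t, 0)` along the geodesic `t ↦ exp_{c 0}(t V 0)`, a *transverse
Jacobi field* in the sense of Lee 2018, Problem 10-14. This file records the first-order data of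
`J` at the initial hypersurface `t = 0`, in the scalar form consumed by the energy method of
`JacobiEnergyEstimates.lean` / `WeinsteinCriterion.lean` (hypothesis `hexit` there):

* `hasDerivAt_val_velocity_normalVariation`: on the strip, `d/dt g(J, J) = 2 g(D_s T, J)(t, 0)`
  (metric compatibility `d/dt g(J, J) = 2 g(D_t J, J)` and the symmetry lemma `D_t J = D_s T`,
  `T = ∂_t x`);
* `covariantDerivAlong_normalVariation_zero`, `velocity_normalVariation_zero`: at `t = 0` one has
  `x(0, s) = c s` and `T(0, s) = V s`, so `D_s T(0, 0) = D_s V(0)` — the covariant derivative of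
  the field `V` along the base curve — and `J(0) = c'(0)`; with the symmetry lemma this is Lee's
  `D_t J(0) = D_s V(0) = -W_{V 0}(c'(0))` for the unit normal field `V` of a hypersurface
  (Problem 10-14 (b), `W` the Weingarten map);
* `hasDerivAt_val_velocity_normalVariation_zero`: hence
  `d/dt|_{t=0} g(J, J) = 2 g(D_s V(0), c'(0))`, i.e. `-2 II_{V 0}(c'(0), c'(0))` — the boundary term
  through which the second fundamental form of Weinstein's sphere `∂D` enters step (4) of the
  proof of the main theorem of Weinstein 1968 (there `II > -λ`).

## References

* J. M. Lee, *Introduction to Riemannian Manifolds*, 2nd ed., Springer GTM 176 (2018), Thm. 6.38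
  and Problem 10-14. [cite: LeeRiemannianManifolds2018, Problem 10-14]
* A. Weinstein, *The cut locus and conjugate locus of a Riemannian manifold*, Ann. of Math. (2)
  87 (1968), 29–41, proof of the main theorem, step (4). [cite: Weinstein1968]

Tags: [TransverseJacobiField] [SecondFundamentalForm] [NormalVariation] [Weinstein1968]
-/

open Bundle Set Filter Function
open scoped Manifold ContDiff Topology

namespace Literature.Geometry.Riemannian

open Literature.Geometry.Lorentzian
open Literature.Geometry.Lorentzian.PseudoRiemannianMetric

variable {E : Type*} [NormedAddCommGroup E] [NormedSpace ℝ E] {H : Type*} [TopologicalSpace H]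
  {I : ModelWithCorners ℝ E H} {M : Type*} [TopologicalSpace M] [ChartedSpace H M]
  [IsManifold I ∞ M] {n : ℕ∞ω} [Fact (1 ≤ n)] [FiniteDimensional ℝ E] [CompleteSpace E]
  (g : PseudoRiemannianMetric I n E (TangentSpace I : M → Type _)) [g.HasLeviCivita]
  [T2Space M] [BoundarylessManifold I M]
  [CovariantDerivative.ContMDiffCovariantDerivative g.leviCivita 1]
  [CovariantDerivative.ContMDiffCovariantDerivative g.leviCivita ((⊤ : ℕ∞) : ℕ∞ω)]

/-! ### At `t = 0`: the variation is the base curve, its velocity field is `V` -/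

omit [Fact (1 ≤ n)]
  [CovariantDerivative.ContMDiffCovariantDerivative g.leviCivita ((⊤ : ℕ∞) : ℕ∞ω)] in
/-- `x(0, ·) = c`: at time `0` the variation through the normal geodesics is the base curve
(`exp_y 0 = y`). [folklore] -/
theorem normalVariation_zero (c : ℝ → M) (V : Π s : ℝ, TangentSpace I (c s)) :
    (fun s ↦ expMap g.leviCivita (c s) ((0 : ℝ) • V s)) = c := by
  funext s
  rw [zero_smul]
  exact expMap_zero (cov := g.leviCivita) (c s)

omit [Fact (1 ≤ n)]
  [CovariantDerivative.ContMDiffCovariantDerivative g.leviCivita ((⊤ : ℕ∞) : ℕ∞ω)] in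
/-- **`J(0) = c'(0)`**: the variation field of `x(t, s) = exp_{c s}(t V s)` at `t = 0` is the
velocity of the base curve. [cite: LeeRiemannianManifolds2018, Problem 10-14] -/
theorem velocity_normalVariation_zero (c : ℝ → M) (V : Π s : ℝ, TangentSpace I (c s)) (s : ℝ) :
    velocity I (fun s ↦ expMap g.leviCivita (c s) ((0 : ℝ) • V s)) s = velocity I c s := by
  rw [normalVariation_zero g c V]

omit [Fact (1 ≤ n)]
  [CovariantDerivative.ContMDiffCovariantDerivative g.leviCivita ((⊤ : ℕ∞) : ℕ∞ω)] in
/-- **`D_s T(0, 0) = D_s V(0)`**: at `t = 0` the velocity field `T(0, s) = ∂_t x(0, s)` of the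
variation `x(t, s) = exp_{c s}(t V s)` is the field `V` itself (`velocity_expMap_smul_zero`) and
the curve `x(0, ·)` is `c`, so the covariant derivative of `T(0, ·)` along `x(0, ·)` at `s = 0` is
the covariant derivative of `V` along the base curve. With the symmetry lemma `D_t J = D_s T` this
is the transversality condition `D_t J(0) = D_s V(0)` of Lee 2018, Problem 10-14 (b)
(`= -W_{V 0}(J(0))` for the unit normal field `V` of a hypersurface).
[cite: LeeRiemannianManifolds2018, Problem 10-14 (b)] -/
theorem covariantDerivAlong_normalVariation_zero (c : ℝ → M) (V : Π s : ℝ, TangentSpace I (c s))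
    (s : ℝ) :
    covariantDerivAlong g.leviCivita (fun s ↦ expMap g.leviCivita (c s) ((0 : ℝ) • V s))
        (fun s ↦ velocity I (fun t : ℝ ↦ expMap g.leviCivita (c s) (t • V s)) 0) s =
      covariantDerivAlong g.leviCivita c V s := by
  have h1 : (fun s ↦ velocity I (fun t : ℝ ↦ expMap g.leviCivita (c s) (t • V s)) 0) =
      fun s ↦ V s :=
    funext fun s ↦ velocity_expMap_smul_zero (cov := g.leviCivita) (c s) (V s)
  rw [h1, normalVariation_zero g c V]

/-! ### The derivative of `g(J, J)` on the strip and at `t = 0` -/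

/-- **`d/dt g(J, J) = 2 g(D_s T, J)` along a variation through normal geodesics.** Let
`s ↦ (c s, V s) ∈ TM` be `C^∞` for `|s| < ε` and let the geodesics `γ_{(c s, V s)}` be defined for
all times in `(a, b)`, `|s| < ε`. Then for `a < t < b` the function
`t ↦ g(J(t), J(t))`, `J(t) = ∂_s x(t, 0)` the variation field of `x(t, s) = exp_{c s}(t V s)`,
has derivative `2 g(D_s T(t, 0), J(t))`, `T = ∂_t x`: metric compatibility
(`hasDerivAt_val_apply_along`) gives `2 g(D_t J, J)`, and `D_t J = D_t ∂_s x = D_s ∂_t x = D_s T`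
by the symmetry lemma (`covariantDerivAlong_velocity_comm`; the variation is `C^∞` on the strip,
`contMDiffAt_uncurry_normalVariation`). [cite: LeeRiemannianManifolds2018, Problem 10-14] -/
theorem hasDerivAt_val_velocity_normalVariation
    {c : ℝ → M} {V : Π s : ℝ, TangentSpace I (c s)} {ε a b : ℝ} (hε : 0 < ε)
    (hcV : ∀ s ∈ Ioo (-ε) ε, ContMDiffAt 𝓘(ℝ, ℝ) I.tangent ∞
      (fun s ↦ (TotalSpace.mk' E (c s) (V s) : TangentBundle I M)) s)
    (hstrip : ∀ t ∈ Ioo a b, ∀ s ∈ Ioo (-ε) ε, t ∈ maximalGeodesicDomain g.leviCivita (c s) (V s))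
    {t : ℝ} (ht : t ∈ Ioo a b) :
    HasDerivAt (fun t : ℝ ↦ g.val (expMap g.leviCivita (c 0) (t • V 0))
        (velocity I (fun s ↦ expMap g.leviCivita (c s) (t • V s)) 0)
        (velocity I (fun s ↦ expMap g.leviCivita (c s) (t • V s)) 0))
      (2 * g.val (expMap g.leviCivita (c 0) (t • V 0))
        (covariantDerivAlong g.leviCivita (fun s ↦ expMap g.leviCivita (c s) (t • V s))
          (fun s ↦ velocity I (fun t : ℝ ↦ expMap g.leviCivita (c s) (t • V s)) t) 0)
        (velocity I (fun s ↦ expMap g.leviCivita (c s) (t • V s)) 0)) t := by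
  have hLC := isLeviCivita_leviCivita_holds (g := g)
  have htor : g.leviCivita.torsion = 0 := hLC.1
  have hcompat : g.IsCompatible g.leviCivita := hLC.2
  set x : ℝ → ℝ → M := fun t s ↦ expMap g.leviCivita (c s) (t • V s) with hx_def
  have h0I : (0 : ℝ) ∈ Ioo (-ε) ε := ⟨by linarith, hε⟩
  -- `exp` is `C^∞` on its open domain `S = {(y, w) | 1 ∈ dom γ_w}`
  set S : Set (TangentBundle I M) :=
    {p | (1 : ℝ) ∈ maximalGeodesicDomain g.leviCivita p.proj p.2} with hS_def
  have hS : IsOpen S := isOpen_setOf_one_mem_maximalGeodesicDomain (cov := g.leviCivita)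
    (k := (⊤ : ℕ∞)) le_top
  have hF : ContMDiffOn I.tangent I ∞
      (fun p : TangentBundle I M ↦ expMap g.leviCivita p.proj p.2) S :=
    contMDiffOn_expMap_totalSpace (cov := g.leviCivita) (k := (⊤ : ℕ∞)) le_top
  have hmemS : (TotalSpace.mk' E (c 0) (t • V 0) : TangentBundle I M) ∈ S := by
    show (1 : ℝ) ∈ maximalGeodesicDomain g.leviCivita (c 0) (t • V 0)
    rw [mem_maximalGeodesicDomain_iff_smul_mem_expDomain, one_smul,
      ← mem_maximalGeodesicDomain_iff_smul_mem_expDomain]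
    exact hstrip t ht 0 h0I
  -- the variation is `C²` at `(t, 0)`
  have h2le : (2 : ℕ∞ω) ≤ ∞ := WithTop.coe_le_coe.mpr le_top
  have hxC : ContMDiffAt (𝓘(ℝ, ℝ).prod 𝓘(ℝ, ℝ)) I 2 (uncurry x) (t, 0) :=
    (contMDiffAt_uncurry_normalVariation (cov := g.leviCivita) hS hF (hcV 0 h0I) hmemS).of_le
      h2le
  -- metric compatibility along `t ↦ x t 0` for the field `J = ∂_s x(·, 0)` paired with itself
  have hJ := mdifferentiableAt_lift_velocity_curry_right hxC
  have hder := g.hasDerivAt_val_apply_along hcompat hJ hJ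
  -- the symmetry lemma `D_t ∂_s x = D_s ∂_t x`
  have hsymm := covariantDerivAlong_velocity_comm g.leviCivita htor hxC
  rw [hsymm] at hder
  set DsT := covariantDerivAlong g.leviCivita (x t) (fun s ↦ velocity I (fun t ↦ x t s) t) 0
    with hDsT
  have e : g.val (x t 0) DsT (velocity I (x t) 0) + g.val (x t 0) (velocity I (x t) 0) DsT =
      2 * g.val (x t 0) DsT (velocity I (x t) 0) := by
    rw [g.symm (x t 0) (velocity I (x t) 0) DsT]
    ring
  rw [e] at hder
  exact hder

/-- **`d/dt|_{t=0} g(J, J) = 2 g(D_s V(0), c'(0))`** — the initial derivative of the energy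
density of the transverse Jacobi field `J = ∂_s x(·, 0)` of the variation
`x(t, s) = exp_{c s}(t V s)` through normal geodesics is twice the pairing of the covariant
derivative of the field `V` along the base curve with the velocity of the base curve (for the unit
normal field `V` of a hypersurface: `-2 II_{V 0}(c'(0), c'(0))`). From
`hasDerivAt_val_velocity_normalVariation` at `t = 0` (`a < 0 < b`), `x(0, ·) = c`,
`T(0, ·) = V` and `J(0) = c'(0)`. [cite: LeeRiemannianManifolds2018, Problem 10-14 (b)] -/
theorem hasDerivAt_val_velocity_normalVariation_zero
    {c : ℝ → M} {V : Π s : ℝ, TangentSpace I (c s)} {ε a b : ℝ} (hε : 0 < ε) (ha : a < 0)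
    (hb : 0 < b)
    (hcV : ∀ s ∈ Ioo (-ε) ε, ContMDiffAt 𝓘(ℝ, ℝ) I.tangent ∞
      (fun s ↦ (TotalSpace.mk' E (c s) (V s) : TangentBundle I M)) s)
    (hstrip : ∀ t ∈ Ioo a b, ∀ s ∈ Ioo (-ε) ε,
      t ∈ maximalGeodesicDomain g.leviCivita (c s) (V s)) :
    HasDerivAt (fun t : ℝ ↦ g.val (expMap g.leviCivita (c 0) (t • V 0))
        (velocity I (fun s ↦ expMap g.leviCivita (c s) (t • V s)) 0)
        (velocity I (fun s ↦ expMap g.leviCivita (c s) (t • V s)) 0))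
      (2 * g.val (c 0) (covariantDerivAlong g.leviCivita c V 0) (velocity I c 0)) 0 := by
  have h := hasDerivAt_val_velocity_normalVariation g hε hcV hstrip (t := 0) ⟨ha, hb⟩
  have hx00 : expMap g.leviCivita (c 0) ((0 : ℝ) • V 0) = c 0 := by
    rw [zero_smul]
    exact expMap_zero (cov := g.leviCivita) (c 0)
  rw [covariantDerivAlong_normalVariation_zero g c V 0, velocity_normalVariation_zero g c V 0,
    hx00] at h
  exact h

omit [Fact (1 ≤ n)]
  [CovariantDerivative.ContMDiffCovariantDerivative g.leviCivita ((⊤ : ℕ∞) : ℕ∞ω)] in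
/-- **Value at `t = 0`: `g(J(0), J(0)) = g(c'(0), c'(0))`.** [folklore] -/
theorem val_velocity_normalVariation_zero (c : ℝ → M) (V : Π s : ℝ, TangentSpace I (c s)) :
    g.val (expMap g.leviCivita (c 0) ((0 : ℝ) • V 0))
        (velocity I (fun s ↦ expMap g.leviCivita (c s) ((0 : ℝ) • V s)) 0)
        (velocity I (fun s ↦ expMap g.leviCivita (c s) ((0 : ℝ) • V s)) 0) =
      g.val (c 0) (velocity I c 0) (velocity I c 0) := by
  have hx00 : expMap g.leviCivita (c 0) ((0 : ℝ) • V 0) = c 0 := by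
    rw [zero_smul]
    exact expMap_zero (cov := g.leviCivita) (c 0)
  rw [velocity_normalVariation_zero g c V 0, hx00]

end Literature.Geometry.Riemannian
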